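import Literature.Computability.QuantumComplexity.ExactThresholdQueryComplexity
import Literature.Computability.QuantumComplexity.GroverSearch
import Literature.Computability.QuantumComplexity.QueryPrograms
import HarnessLib

/-!
# Exact quantum query complexity of PARITY: `Q_E(PARITY_N) = ⌈N/2⌉` (Beals–Buhrman–Cleve–Mosca–de Wolf, Prop. 6.4)

Topic `Computability/QuantumComplexity`. R. Beals, H. Buhrman, R. Cleve, M. Mosca, R. de Wolf,
*Quantum lower bounds by polynomials*, J. ACM 48 (2001) [BealsEtAl2001], §6 (held text
`paper:arxiv-quant-ph_9802049`, p. 12 L56–66 and L90):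

> Like the OR-function, PARITY has `deg(f) = N`, so by Theorem 4.3 exact computation requires at
> least `N/2` queries. This is also sufficient. It is well known that the XOR of 2 variables can be
> computed using only one query [CEMM98]. We can group the `N` variables of `X` as `N/2` pairs:
> `(x_0, x_1), (x_2, x_3), …, (x_{N−2}, x_{N−1})`, and compute the XOR of all `N/2` pairs using `N/2`
> queries. The parity of `X` is the parity of these `N/2` XOR values, which can be computed without
> any further queries. […]
> **Proposition 6.4.** If `f` is PARITY on `{0,1}^N`, then `Q_E(f) = Q_0(f) = Q_2(f) = N/2`.

(`⌈N/2⌉` for odd `N`, as in the paper's summary table, p. 4.) The one-query XOR of two bits is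
Deutsch's problem in the form of R. Cleve, A. Ekert, C. Macchiavello, M. Mosca, *Quantum algorithms
revisited*, Proc. R. Soc. A 454 (1998), §3 [CleveEtAl1998] (phase kickback on the target `|−⟩`).

## What is typed

In the tree's query model `QQueryAlg N` (`QuantumQuery.lean`; exact measure
`Q_E = quantumQueryComplexity 0`), for the parity function `x ↦ [Odd |x|]` (`|x| = Grover.hw x`; this
is `Literature/Barriers/PQCSecurity/ParityTestFloor.parityFn` by `rfl`, no Barriers file imported):

* **The XOR-trick program** `parityProg N` (`N ≥ 2`), a straight-line program of
  `QueryPrograms.lean` on the basis `Fin N × Bool × Unit` making `⌈N/2⌉` queries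
  (`numQueries_parityProg`): a Householder gate prepares `(e₀ + e₁)/√2 ⊗ |−⟩`; for each pair
  `(2k, 2k+1)` one query acts by phase kickback (`Grover.queryOracle_mulVec_tens_ketMinus`), so the
  running parity is carried as the relative SIGN of `(e_{2k} ± e_{2k+1})/√2`, and a permutation gate
  moves the pair state to the next pair (`runTok_pairProg`); the pair-Hadamard — the tree's
  `householder` with column `(e_a + e_b)/√2`, which exchanges `e_a ↔ (e_a+e_b)/√2` and
  `e_b ↔ (e_a−e_b)/√2` (`householder_mulVec_pairVec`) — and the target rotation `Grover.trotGU`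
  (`|−⟩ ↦ |0⟩`) decode the sign into a basis state; for odd `N` a permutation gate and one more
  (classical) query add `x_{N−1}` into the target. The acceptance probability is EXACTLY `[Odd |x|]`
  (`parityAlg_acceptProb`), so the program computes parity with error `0`
  (`parityAlg_computesWithError`).
* **The floor** `⌈N/2⌉ ≤ Q_E(PARITY_N)` as printed ("PARITY has `deg(f) = N`, so by Theorem 4.3 …"):
  the top Walsh coefficient of `[Odd |x|]` is `−#{x : Odd |x|} ≠ 0`, while the acceptance polynomial of
  an error-free `T`-query algorithm has degree `≤ 2T` (`ExactThreshold.hasDegreeLE_acceptProb`,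
  `ExactSearch.sum_mul_walsh_univ_eq_zero`) — `le_two_mul_queries_of_computesWithError_zero_parity`.
* **Prop. 6.4, exact clause**: `quantumQueryComplexity 0 (x ↦ [Odd |x|]) = (N + 1) / 2`
  (`quantumQueryComplexity_zero_parity`), and the ceiling at every error `0 ≤ ε`
  (`quantumQueryComplexity_parity_le`). The bounded-error floor (`Q_2 = N/2`, via
  `deg~(PARITY) = N`, Lemma 6.3) is not re-typed here — it is the dual-witness floor of
  `Literature/Barriers/PQCSecurity/ParityTestFloor.lean`; the zero-error measure `Q_0` is not a tree
  object.

## References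

* [BealsEtAl2001] R. Beals, H. Buhrman, R. Cleve, M. Mosca, R. de Wolf, *Quantum lower bounds by
  polynomials*, J. ACM 48(4) (2001) 778–797; arXiv:quant-ph/9802049 — §6 (p. 12 L56–66), Prop. 6.4
  (p. 12 L90), Thm. 4.3 (p. 7 L89).
* [CleveEtAl1998] R. Cleve, A. Ekert, C. Macchiavello, M. Mosca, *Quantum algorithms revisited*,
  Proc. R. Soc. Lond. A 454 (1998) 339–354, §3 (Deutsch's problem with one query).
-/

noncomputable section

open Finset Matrix
open scoped Kronecker
open Literature.Computability.Cryptography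
open Literature.Probability.RandomGraphs.LowDegree (walsh)
open Literature.Computability.QuantumComplexity.ExactSearch (sum_mul_walsh_univ_eq_zero)
open Literature.Computability.QuantumComplexity.ExactThreshold (hasDegreeLE_acceptProb acceptProb_eq_ind
  walsh_univ_eq_neg_one_pow_hw)
open Literature.Computability.QuantumComplexity.QProg
open Literature.Computability.QuantumComplexity.Grover (tens tens_apply tens_smul ketMinus ketZero flipSign
  rhalf rhalf_mul_rhalf rhalfC_mul_rhalfC queryOracle_mulVec_tens_ketMinus kron_one_mulVec_tens trotGU
  trotGU_mulVec_tens_ketMinus hw)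

namespace Literature.Computability.QuantumComplexity.ExactParity

variable {N : ℕ}

/-! ### Pair states `(e_a + s·e_b)/√2` and the sign of a bit -/

/-- The sign `(−1)^b` of a bit, in `ℂ`. [folklore] -/
def sgnC (b : Bool) : ℂ := if b then -1 else 1

/-- `sgnC b = ±1`. [folklore] -/
private theorem sgnC_eq_or (b : Bool) : sgnC b = 1 ∨ sgnC b = -1 := by cases b <;> simp [sgnC]

/-- `sgnC b · sgnC b = 1`. [folklore] -/
@[simp] private theorem sgnC_mul_self (b : Bool) : sgnC b * sgnC b = 1 := by cases b <;> simp [sgnC]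

/-- The pair state `(e_a + s·e_b)/√2` on the index register (Deutsch's two-point superposition).
[cite: CleveEtAl1998, §3] -/
def pairVec (a b : Fin N) (s : ℂ) : Fin N → ℂ :=
  fun i => if i = a then (rhalf : ℂ) else if i = b then s * rhalf else 0

/-- **Phase kickback on a pair**: the sign flip of the marked amplitudes turns `(e_a + s e_b)/√2` into
`(−1)^{x_a} · (e_a + (−1)^{x_a ⊕ x_b} s e_b)/√2` — the XOR of the pair enters the relative sign.
[cite: CleveEtAl1998, §3] -/
theorem flipSign_pairVec {a b : Fin N} (hab : a ≠ b) (x : Fin N → Bool) (s : ℂ) :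
    flipSign x (pairVec a b s) = sgnC (x a) • pairVec a b (sgnC (x a) * sgnC (x b) * s) := by
  funext i
  simp only [flipSign, pairVec, Pi.smul_apply, smul_eq_mul]
  by_cases hia : i = a
  · subst hia
    simp only [if_true]
    cases x i <;> simp [sgnC]
  · rw [if_neg hia, if_neg hia]
    by_cases hib : i = b
    · subst hib
      simp only [if_true]
      have h : sgnC (x a) * (sgnC (x a) * sgnC (x i) * s * (rhalf : ℂ)) =
          sgnC (x i) * (s * rhalf) := by
        rw [show sgnC (x a) * (sgnC (x a) * sgnC (x i) * s * (rhalf : ℂ)) =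
          (sgnC (x a) * sgnC (x a)) * (sgnC (x i) * (s * rhalf)) by ring, sgnC_mul_self, one_mul]
      rw [h]
      cases x i <;> simp [sgnC]
    · simp [hib]

/-- Relabelling a pair state along a permutation of the indices. [folklore] -/
private theorem pairVec_comp_perm (σ : Equiv.Perm (Fin N)) (a b : Fin N) (s : ℂ) :
    pairVec a b s ∘ σ = pairVec (σ.symm a) (σ.symm b) s := by
  funext i
  simp only [Function.comp_apply, pairVec, Equiv.apply_eq_iff_eq_symm_apply]

/-- `(e_a + e_b)/√2 + (e_a − e_b)/√2 = √2·e_a`, i.e. `pairVec a b (−1) = (2/√2)·e_a − pairVec a b 1`.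
[folklore] -/
private theorem pairVec_neg_one (a b : Fin N) :
    pairVec a b (-1) = (2 * (rhalf : ℂ)) • Pi.single a (1 : ℂ) - pairVec a b 1 := by
  funext i
  simp only [pairVec, Pi.sub_apply, Pi.smul_apply, smul_eq_mul]
  by_cases hia : i = a
  · subst hia
    rw [if_pos rfl, if_pos rfl, Pi.single_eq_same]; ring
  · rw [if_neg hia, if_neg hia, Pi.single_eq_of_ne hia]
    split_ifs <;> ring

/-! ### Gates: index permutations, the pair-Hadamard, the preparation -/

/-- An index permutation `σ`, acting as `σ ⊗ 1` on `Fin N × Bool × Unit` (a permutation matrix, hence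
unitary). [folklore] -/
def liftGate (σ : Equiv.Perm (Fin N)) : Matrix.unitaryGroup (Fin N × Bool × Unit) ℂ :=
  ⟨Equiv.Perm.permMatrix ℂ (Equiv.prodCongr σ (Equiv.refl (Bool × Unit))), permMatrix_mem_unitaryGroup _⟩

/-- `(σ ⊗ 1)(v ⊗ m) = (v ∘ σ) ⊗ m`. [folklore] -/
private theorem liftGate_mulVec_tens (σ : Equiv.Perm (Fin N)) (v : Fin N → ℂ) (m : Bool × Unit → ℂ) :
    (liftGate σ : Matrix _ _ ℂ) *ᵥ tens v m = tens (v ∘ σ) m := by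
  funext ⟨i, p⟩
  simp only [liftGate, Matrix.permMatrix_mulVec, Function.comp_apply, Equiv.prodCongr_apply,
    Prod.map_apply, Equiv.coe_refl, tens_apply]
  rfl

/-- A basis permutation `τ` of `Fin N × Bool × Unit` as a unitary gate. [folklore] -/
def permGate (τ : Equiv.Perm (Fin N × Bool × Unit)) : Matrix.unitaryGroup (Fin N × Bool × Unit) ℂ :=
  ⟨τ.permMatrix ℂ, permMatrix_mem_unitaryGroup _⟩

/-- A basis permutation gate maps `e_s` to `e_{τ⁻¹ s}`. [folklore] -/
private theorem permGate_mulVec_single (τ : Equiv.Perm (Fin N × Bool × Unit)) (s : Fin N × Bool × Unit)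
    (c : ℂ) : (permGate τ : Matrix _ _ ℂ) *ᵥ Pi.single s c = Pi.single (τ.symm s) c :=
  permMatrix_mulVec_single τ s c

/-- The real column `(e_a + e_b)/√2` of the pair-Hadamard. [folklore] -/
def hadReal (a b : Fin N) : Fin N → ℝ := fun i => if i = a then rhalf else if i = b then rhalf else 0

/-- `(e_a + e_b)/√2` is a unit vector (`a ≠ b`). [folklore] -/
private theorem sum_hadReal_sq {a b : Fin N} (hab : a ≠ b) : ∑ l, hadReal a b l ^ 2 = 1 := by
  have h : ∀ l, hadReal a b l ^ 2 = (if l = a then (1 / 2 : ℝ) else 0) + (if l = b then 1 / 2 else 0) := by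
    intro l
    simp only [hadReal]
    by_cases hla : l = a
    · subst hla
      rw [if_pos rfl, if_pos rfl, if_neg hab, sq, rhalf_mul_rhalf]; ring
    · rw [if_neg hla, if_neg hla]
      by_cases hlb : l = b
      · subst hlb
        rw [if_pos rfl, if_pos rfl, sq, rhalf_mul_rhalf]; ring
      · rw [if_neg hlb, if_neg hlb]; ring
  rw [Finset.sum_congr rfl fun l _ => h l, Finset.sum_add_distrib, Finset.sum_ite_eq' univ a,
    Finset.sum_ite_eq' univ b]
  simp; norm_num

/-- The real column, cast to `ℂ`, is `pairVec a b 1`. [folklore] -/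
private theorem hadReal_cast (a b : Fin N) : (fun i => (hadReal a b i : ℂ)) = pairVec a b 1 := by
  funext i
  simp only [hadReal, pairVec, one_mul]
  split_ifs <;> simp

/-- The Householder matrix is an involution: `H · H = 1`. [folklore] -/
private theorem householder_mul_self {ι : Type*} [Fintype ι] [DecidableEq ι] (c : ι → ℝ) (k₀ : ι) :
    householder c k₀ * householder c k₀ = 1 := by
  unfold householder
  rw [← Matrix.map_mul, hhReal_mul_self]
  simp

/-- **The pair-Hadamard** `H_{ab}` (the Householder reflection with column `(e_a + e_b)/√2` at `a`)
decodes the relative sign: `H_{ab} (e_a + e_b)/√2 = e_a` and `H_{ab} (e_a − e_b)/√2 = e_b`.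
[cite: CleveEtAl1998, §3] -/
theorem householder_mulVec_pairVec {a b : Fin N} (hab : a ≠ b) {s : ℂ} (hs : s = 1 ∨ s = -1) :
    householder (hadReal a b) a *ᵥ pairVec a b s =
      Pi.single (if s = 1 then a else b) (1 : ℂ) := by
  have h1 : householder (hadReal a b) a *ᵥ Pi.single a (1 : ℂ) = pairVec a b 1 := by
    rw [householder_mulVec_single (sum_hadReal_sq hab), hadReal_cast]
  have h2 : householder (hadReal a b) a *ᵥ pairVec a b 1 = Pi.single a (1 : ℂ) := by
    rw [← h1, Matrix.mulVec_mulVec, householder_mul_self, Matrix.one_mulVec]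
  rcases hs with rfl | rfl
  · rw [if_pos rfl, h2]
  · rw [if_neg (by norm_num), pairVec_neg_one, Matrix.mulVec_sub, Matrix.mulVec_smul, h1, h2]
    funext i
    simp only [Pi.sub_apply, Pi.smul_apply, smul_eq_mul, pairVec]
    by_cases hia : i = a
    · subst hia
      rw [Pi.single_eq_same, if_pos rfl, Pi.single_eq_of_ne hab]
      have h := rhalfC_mul_rhalfC
      linear_combination (2 : ℂ) * h
    · rw [Pi.single_eq_of_ne hia, if_neg hia]
      by_cases hib : i = b
      · subst hib
        rw [if_pos rfl, Pi.single_eq_same]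
        have h := rhalfC_mul_rhalfC
        linear_combination (2 : ℂ) * h
      · rw [if_neg hib, Pi.single_eq_of_ne hib]; ring

/-- The pair-Hadamard as a gate `H_{ab} ⊗ 1` on `Fin N × Bool × Unit`. [cite: CleveEtAl1998, §3] -/
def hadGate (a b : Fin N) : Matrix.unitaryGroup (Fin N × Bool × Unit) ℂ :=
  ⟨householder (hadReal a b) a ⊗ₖ (1 : Matrix (Bool × Unit) (Bool × Unit) ℂ),
    Matrix.kronecker_mem_unitary (householder_mem_unitaryGroup _ _) (Submonoid.one_mem _)⟩

/-- `(H_{ab} ⊗ 1)((e_a + s e_b)/√2 ⊗ m) = e_{a or b} ⊗ m`. [cite: CleveEtAl1998, §3] -/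
theorem hadGate_mulVec_tens {a b : Fin N} (hab : a ≠ b) {s : ℂ} (hs : s = 1 ∨ s = -1)
    (m : Bool × Unit → ℂ) :
    (hadGate a b : Matrix _ _ ℂ) *ᵥ tens (pairVec a b s) m =
      tens (Pi.single (if s = 1 then a else b) (1 : ℂ)) m := by
  rw [← householder_mulVec_pairVec hab hs]
  exact kron_one_mulVec_tens _ _ _

/-- `e_j ⊗ |0⟩` is the basis state `|j, 0⟩`. [folklore] -/
private theorem tens_single_ketZero (j : Fin N) :
    tens (Pi.single j (1 : ℂ)) ketZero = Pi.single (j, false, ()) (1 : ℂ) := by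
  funext ⟨i, c, u⟩
  simp only [tens_apply, ketZero]
  by_cases hij : i = j
  · subst hij
    cases c
    · simp
    · simp [Pi.single_eq_of_ne]
  · rw [Pi.single_eq_of_ne hij, zero_mul, Pi.single_eq_of_ne]
    intro h; exact hij (congrArg Prod.fst h)

/-- The real amplitudes of the prepared state `(e_a + e_b)/√2 ⊗ |−⟩`. [folklore] -/
def prepReal (a b : Fin N) : Fin N × Bool × Unit → ℝ :=
  fun s => hadReal a b s.1 * (if s.2.1 then -rhalf else rhalf)

/-- The prepared state is a unit vector (`a ≠ b`). [folklore] -/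
private theorem sum_prepReal_sq {a b : Fin N} (hab : a ≠ b) : ∑ s, prepReal a b s ^ 2 = 1 := by
  have h : ∀ s : Fin N × Bool × Unit, prepReal a b s ^ 2 = hadReal a b s.1 ^ 2 * (1 / 2) := by
    intro s
    simp only [prepReal, mul_pow]
    congr 1
    split_ifs <;> nlinarith [rhalf_mul_rhalf]
  simp_rw [h]
  rw [Fintype.sum_prod_type]
  simp only [Fintype.sum_prod_type, Fintype.sum_bool, Finset.univ_unique, Finset.sum_singleton]
  have h2 : ∀ i, hadReal a b i ^ 2 * (1 / 2) + hadReal a b i ^ 2 * (1 / 2) = hadReal a b i ^ 2 :=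
    fun i => by ring
  simp_rw [h2]
  exact sum_hadReal_sq hab

/-- The prepared amplitudes, cast to `ℂ`, are `(e_a + e_b)/√2 ⊗ |−⟩`. [folklore] -/
private theorem prepReal_cast (a b : Fin N) :
    (fun s => (prepReal a b s : ℂ)) = tens (pairVec a b 1) ketMinus := by
  funext ⟨i, c, u⟩
  simp only [prepReal, tens_apply, hadReal, pairVec, ketMinus, one_mul]
  split_ifs <;> push_cast <;> ring

/-- The preparation gate `|start⟩ ↦ (e_a + e_b)/√2 ⊗ |−⟩` (a Householder reflection, as for Grover's
`preGU`). [cite: CleveEtAl1998, §3] -/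
def prepGate (a b : Fin N) (start : Fin N × Bool × Unit) : Matrix.unitaryGroup (Fin N × Bool × Unit) ℂ :=
  ⟨householder (prepReal a b) start, householder_mem_unitaryGroup _ _⟩

/-- The preparation gate sends `e_start` to `(e_a + e_b)/√2 ⊗ |−⟩`. [cite: CleveEtAl1998, §3] -/
theorem prepGate_mulVec_single {a b : Fin N} (hab : a ≠ b) (start : Fin N × Bool × Unit) :
    (prepGate a b start : Matrix _ _ ℂ) *ᵥ Pi.single start 1 = tens (pairVec a b 1) ketMinus := by
  rw [← prepReal_cast]
  exact householder_mulVec_single (sum_prepReal_sq hab) _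

/-- A classical query on a basis state: `O_x |i, c⟩ = |i, c ⊕ x_i⟩`. [cite: BealsEtAl2001, §2] -/
theorem queryOracle_mulVec_single (x : Fin N → Bool) (i : Fin N) (c : Bool) (z : ℂ) :
    queryOracle x *ᵥ Pi.single (i, c, ()) z = Pi.single (i, (c ^^ x i), ()) z := by
  funext ⟨j, d, u⟩
  rw [queryOracle_mulVec_apply]
  by_cases hji : j = i
  · subst hji
    by_cases hd : d = (c ^^ x j)
    · subst hd
      have : ((c ^^ x j) ^^ x j) = c := by cases c <;> cases x j <;> rfl
      simp [this]
    · rw [Pi.single_eq_of_ne, Pi.single_eq_of_ne]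
      · intro h; exact hd (by have := congrArg (fun p => p.2.1) h; simpa using this)
      · intro h
        have h' : (d ^^ x j) = c := by have := congrArg (fun p => p.2.1) h; simpa using this
        exact hd (by rw [← h']; cases d <;> cases x j <;> rfl)
  · rw [Pi.single_eq_of_ne, Pi.single_eq_of_ne]
    · intro h; exact hji (congrArg Prod.fst h)
    · intro h; exact hji (congrArg Prod.fst h)

/-! ### Indices and the running sign -/

/-- The `j`-th index as an element of `Fin N` (`j mod N`; used only for `j < N`). [folklore] -/
def idx (N : ℕ) [NeZero N] (j : ℕ) : Fin N := Fin.ofNat N j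

/-- `idx N j` has value `j` for `j < N`. [folklore] -/
private theorem idx_val [NeZero N] {j : ℕ} (hj : j < N) : (idx N j).val = j := by
  rw [idx, Fin.val_ofNat, Nat.mod_eq_of_lt hj]

/-- Distinct small naturals give distinct indices. [folklore] -/
private theorem idx_ne [NeZero N] {j j' : ℕ} (hj : j < N) (hj' : j' < N) (h : j ≠ j') : idx N j ≠ idx N j' := by
  intro he
  have := congrArg Fin.val he
  rw [idx_val hj, idx_val hj'] at this
  exact h this

/-- `idx N i.val = i`. [folklore] -/
private theorem idx_val_self [NeZero N] (i : Fin N) : idx N i.val = i :=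
  Fin.ext (idx_val i.isLt)

/-- The number of `1`s among `x_0, …, x_{n−1}`. [folklore] -/
def onesBelow [NeZero N] (x : Fin N → Bool) (n : ℕ) : ℕ :=
  ((range n).filter fun j => x (idx N j) = true).card

/-- `onesBelow` step. [folklore] -/
private theorem onesBelow_succ [NeZero N] (x : Fin N → Bool) (n : ℕ) :
    onesBelow x (n + 1) = onesBelow x n + (if x (idx N n) = true then 1 else 0) := by
  unfold onesBelow
  rw [Finset.range_add_one, Finset.filter_insert]
  split_ifs with h
  · rw [Finset.card_insert_of_notMem (by simp)]
  · rfl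

/-- All `N` bits: `onesBelow x N = |x|`. [folklore] -/
private theorem onesBelow_self [NeZero N] (x : Fin N → Bool) : onesBelow x N = hw x := by
  unfold onesBelow hw
  rw [Finset.card_filter, Finset.card_filter, ← Fin.sum_univ_eq_sum_range]
  simp only [idx_val_self]

/-- The running sign `(−1)^{x_0 ⊕ ⋯ ⊕ x_{n−1}}`. [cite: BealsEtAl2001, §6 ("the parity of these XOR values")] -/
def relSign [NeZero N] (x : Fin N → Bool) (n : ℕ) : ℂ := (-1) ^ onesBelow x n

/-- `relSign = ±1`. [folklore] -/
private theorem relSign_eq_or [NeZero N] (x : Fin N → Bool) (n : ℕ) : relSign x n = 1 ∨ relSign x n = -1 :=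
  neg_one_pow_eq_or ℂ _

/-- One more bit multiplies the running sign by its sign. [cite: BealsEtAl2001, §6] -/
theorem relSign_succ [NeZero N] (x : Fin N → Bool) (n : ℕ) :
    relSign x (n + 1) = sgnC (x (idx N n)) * relSign x n := by
  unfold relSign
  rw [onesBelow_succ, pow_add]
  cases x (idx N n) <;> simp only [sgnC, Bool.false_eq_true, ↓reduceIte, pow_one, pow_zero] <;> ring

/-- Two more bits multiply the running sign by their signs. [cite: BealsEtAl2001, §6] -/
theorem relSign_add_two [NeZero N] (x : Fin N → Bool) (n : ℕ) :
    relSign x (n + 2) = sgnC (x (idx N n)) * sgnC (x (idx N (n + 1))) * relSign x n := by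
  unfold relSign
  rw [show n + 2 = n + 1 + 1 from rfl, onesBelow_succ, onesBelow_succ, pow_add, pow_add]
  cases x (idx N n) <;> cases x (idx N (n + 1)) <;>
    simp only [sgnC, Bool.false_eq_true, ↓reduceIte, pow_one, pow_zero] <;> ring

/-- `relSign x 0 = 1`. [folklore] -/
private theorem relSign_zero [NeZero N] (x : Fin N → Bool) : relSign x 0 = 1 := by
  simp [relSign, onesBelow]

/-- The full sign is `(−1)^{|x|}`: `−1` iff the parity is odd. [cite: BealsEtAl2001, §6] -/
theorem relSign_self [NeZero N] (x : Fin N → Bool) :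
    relSign x N = if Odd (hw x) then -1 else 1 := by
  rw [relSign, onesBelow_self]
  split_ifs with h
  · exact h.neg_one_pow
  · exact (Nat.not_odd_iff_even.1 h).neg_one_pow

/-! ### The pair phase of the program and its invariant -/

/-- The start state `|0, 0⟩`. [folklore] -/
def startP (N : ℕ) [NeZero N] : Fin N × Bool × Unit := (idx N 0, false, ())

/-- The gate moving pair `(2k, 2k+1)` to pair `(2k+2, 2k+3)`. [cite: BealsEtAl2001, §6] -/
def shiftGate (N : ℕ) [NeZero N] (k : ℕ) : Matrix.unitaryGroup (Fin N × Bool × Unit) ℂ :=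
  liftGate (Equiv.swap (idx N (2 * k)) (idx N (2 * k + 2)) * Equiv.swap (idx N (2 * k + 1)) (idx N (2 * k + 3)))

/-- Rounds `1, …, k` of the pair phase: move to the next pair, query. [cite: BealsEtAl2001, §6] -/
def pairTail (N : ℕ) [NeZero N] : ℕ → List (QTok N Unit)
  | 0 => []
  | k + 1 => pairTail N k ++ [QTok.gate (shiftGate N k), QTok.query]

/-- The pair phase through pair `k`: prepare `(e₀ + e₁)/√2 ⊗ |−⟩`, query, then rounds `1, …, k`
(`k + 1` queries). [cite: BealsEtAl2001, §6] -/
def pairProg (N : ℕ) [NeZero N] (k : ℕ) : List (QTok N Unit) :=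
  [QTok.gate (prepGate (idx N 0) (idx N 1) (startP N)), QTok.query] ++ pairTail N k

/-- Unfolding the pair phase: pair `0`. [cite: BealsEtAl2001, §6] -/
theorem pairProg_zero [NeZero N] :
    pairProg N 0 = [QTok.gate (prepGate (idx N 0) (idx N 1) (startP N)), QTok.query] := by
  simp [pairProg, pairTail]

/-- Unfolding the pair phase: one more round. [cite: BealsEtAl2001, §6] -/
theorem pairProg_succ [NeZero N] (k : ℕ) :
    pairProg N (k + 1) = pairProg N k ++ [QTok.gate (shiftGate N k), QTok.query] := by
  simp [pairProg, pairTail]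

/-- The pair phase through pair `k` makes `k + 1` queries. [cite: BealsEtAl2001, §6] -/
theorem numQueries_pairProg [NeZero N] (k : ℕ) : numQueries (pairProg N k) = k + 1 := by
  induction k with
  | zero => rw [pairProg_zero]; rfl
  | succ k ih => rw [pairProg_succ, numQueries_append, ih]; rfl

/-- The shift gate relabels the pair state. [cite: BealsEtAl2001, §6] -/
theorem shiftGate_mulVec_tens [NeZero N] {k : ℕ} (hk : 2 * k + 3 < N) (s : ℂ) (m : Bool × Unit → ℂ) :
    (shiftGate N k : Matrix _ _ ℂ) *ᵥ tens (pairVec (idx N (2 * k)) (idx N (2 * k + 1)) s) m =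
      tens (pairVec (idx N (2 * k + 2)) (idx N (2 * k + 3)) s) m := by
  have h1 : idx N (2 * k + 2) ≠ idx N (2 * k + 1) := idx_ne (by omega) (by omega) (by omega)
  have h2 : idx N (2 * k + 2) ≠ idx N (2 * k + 3) := idx_ne (by omega) (by omega) (by omega)
  have h3 : idx N (2 * k + 1) ≠ idx N (2 * k) := idx_ne (by omega) (by omega) (by omega)
  have h4 : idx N (2 * k + 1) ≠ idx N (2 * k + 2) := idx_ne (by omega) (by omega) (by omega)
  have hσa : (Equiv.swap (idx N (2 * k)) (idx N (2 * k + 2)) *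
      Equiv.swap (idx N (2 * k + 1)) (idx N (2 * k + 3))).symm (idx N (2 * k)) = idx N (2 * k + 2) := by
    rw [Equiv.symm_apply_eq, Equiv.Perm.mul_apply, Equiv.swap_apply_of_ne_of_ne h1 h2,
      Equiv.swap_apply_right]
  have hσb : (Equiv.swap (idx N (2 * k)) (idx N (2 * k + 2)) *
      Equiv.swap (idx N (2 * k + 1)) (idx N (2 * k + 3))).symm (idx N (2 * k + 1)) =
      idx N (2 * k + 3) := by
    rw [Equiv.symm_apply_eq, Equiv.Perm.mul_apply, Equiv.swap_apply_right,
      Equiv.swap_apply_of_ne_of_ne h3 h4]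
  rw [shiftGate, liftGate_mulVec_tens, pairVec_comp_perm, hσa, hσb]

/-- **Invariant of the pair phase.** After the pair phase through pair `k` (`2k + 1 < N`) the state is
`± (e_{2k} + σ e_{2k+1})/√2 ⊗ |−⟩` with `σ = (−1)^{x_0 ⊕ ⋯ ⊕ x_{2k+1}}`: each query computes the XOR of
its pair into the relative sign. [cite: BealsEtAl2001, §6] -/
theorem runTok_pairProg [NeZero N] (x : Fin N → Bool) :
    ∀ k : ℕ, 2 * k + 1 < N → ∃ c : ℂ, (c = 1 ∨ c = -1) ∧
      runTok x (pairProg N k) (Pi.single (startP N) 1) =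
        c • tens (pairVec (idx N (2 * k)) (idx N (2 * k + 1)) (relSign x (2 * k + 2))) ketMinus
  | 0, h0 => by
    refine ⟨sgnC (x (idx N 0)), sgnC_eq_or _, ?_⟩
    have h01 : idx N 0 ≠ idx N 1 := idx_ne (by omega) h0 (by omega)
    rw [pairProg_zero]
    simp only [runTok_cons, runTok_nil, QTok.mat]
    rw [prepGate_mulVec_single h01, queryOracle_mulVec_tens_ketMinus, flipSign_pairVec h01,
      tens_smul, relSign_add_two, relSign_zero, mul_one]
  | k + 1, hk => by
    obtain ⟨c, hc, hrun⟩ := runTok_pairProg x k (by omega)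
    have hab : idx N (2 * (k + 1)) ≠ idx N (2 * (k + 1) + 1) := idx_ne (by omega) hk (by omega)
    refine ⟨c * sgnC (x (idx N (2 * (k + 1)))), ?_, ?_⟩
    · rcases hc with rfl | rfl <;> rcases sgnC_eq_or (x (idx N (2 * (k + 1)))) with h | h <;>
        simp [h]
    rw [pairProg_succ, runTok_append, hrun]
    simp only [runTok_cons, runTok_nil, QTok.mat]
    rw [Matrix.mulVec_smul, shiftGate_mulVec_tens (by omega), Matrix.mulVec_smul,
      show 2 * k + 2 = 2 * (k + 1) by ring, show 2 * k + 3 = 2 * (k + 1) + 1 by ring,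
      queryOracle_mulVec_tens_ketMinus, flipSign_pairVec hab, tens_smul, smul_smul,
      relSign_add_two x (2 * (k + 1))]

/-! ### Decoding, the odd tail, and the whole program -/

/-- The last pair `(a, b) = (2m − 2, 2m − 1)`, `m = ⌊N/2⌋`. [folklore] -/
def lastA (N : ℕ) [NeZero N] : Fin N := idx N (2 * (N / 2 - 1))

/-- See `lastA`. [folklore] -/
def lastB (N : ℕ) [NeZero N] : Fin N := idx N (2 * (N / 2 - 1) + 1)

/-- The tail permutation for odd `N`: `|a, 0⟩ ↦ |N−1, 0⟩`, `|b, 0⟩ ↦ |N−1, 1⟩`. [cite: BealsEtAl2001, §6] -/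
def tailPerm (N : ℕ) [NeZero N] : Equiv.Perm (Fin N × Bool × Unit) :=
  Equiv.swap (idx N (N - 1), false, ()) (lastA N, false, ()) *
    Equiv.swap (idx N (N - 1), true, ()) (lastB N, false, ())

/-- The decoding gates, and for odd `N` the classical tail. [cite: BealsEtAl2001, §6] -/
def endProg (N : ℕ) [NeZero N] : List (QTok N Unit) :=
  [QTok.gate (hadGate (lastA N) (lastB N)), QTok.gate (trotGU N)] ++
    (if N % 2 = 1 then [QTok.gate (permGate (tailPerm N)), QTok.query] else [])

/-- **The XOR-trick program for PARITY** (`N ≥ 2`): pair phase through the last pair, decoding, odd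
tail. [cite: BealsEtAl2001, §6] -/
def parityProg (N : ℕ) [NeZero N] : List (QTok N Unit) := pairProg N (N / 2 - 1) ++ endProg N

/-- The accepting basis state. [cite: BealsEtAl2001, §6] -/
def acceptP (N : ℕ) [NeZero N] : Set (Fin N × Bool × Unit) :=
  if N % 2 = 1 then {(idx N (N - 1), true, ())} else {(lastB N, false, ())}

/-- The parity algorithm in the model `QQueryAlg N`. [cite: BealsEtAl2001, Prop. 6.4] -/
def parityAlg (N : ℕ) [NeZero N] : QQueryAlg N := toAlg (parityProg N) (startP N) (acceptP N)

/-- **`⌈N/2⌉` queries.** [cite: BealsEtAl2001, §6] -/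
theorem numQueries_parityProg [NeZero N] (hN : 2 ≤ N) : numQueries (parityProg N) = (N + 1) / 2 := by
  rw [parityProg, numQueries_append, numQueries_pairProg, endProg, numQueries_append]
  split_ifs with h
  · show N / 2 - 1 + 1 + (0 + (0 + 1)) = (N + 1) / 2
    omega
  · show N / 2 - 1 + 1 + (0 + 0) = (N + 1) / 2
    omega

/-- The parity algorithm makes `⌈N/2⌉` queries. [cite: BealsEtAl2001, Prop. 6.4] -/
theorem parityAlg_queries [NeZero N] (hN : 2 ≤ N) : (parityAlg N).queries = (N + 1) / 2 := by
  rw [parityAlg, toAlg_queries, numQueries_parityProg hN]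

/-- The weight of a singleton on a scaled basis state. [folklore] -/
private theorem wt_singleton_smul_single {c : ℂ} (hc : c = 1 ∨ c = -1) (s t : Fin N × Bool × Unit) :
    wt {t} (c • Pi.single s (1 : ℂ)) = if s = t then 1 else 0 := by
  classical
  unfold wt
  rw [Finset.sum_filter]
  simp only [Set.mem_singleton_iff, Finset.sum_ite_eq', Finset.mem_univ, if_true, Pi.smul_apply,
    smul_eq_mul]
  by_cases hst : s = t
  · subst hst
    rw [if_pos rfl, Pi.single_eq_same, mul_one]
    rcases hc with rfl | rfl <;> simp
  · rw [if_neg hst, Pi.single_eq_of_ne (Ne.symm hst), mul_zero, norm_zero]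
    simp

/-- **The program computes PARITY exactly**: its acceptance probability on `x` is `[Odd |x|]`
(`N ≥ 2`). [cite: BealsEtAl2001, Prop. 6.4] -/
theorem parityAlg_acceptProb [NeZero N] (hN : 2 ≤ N) (x : Fin N → Bool) :
    (parityAlg N).acceptProb x = if Odd (hw x) then 1 else 0 := by
  have hm : 2 * (N / 2 - 1) + 1 < N := by omega
  obtain ⟨c, hc, hrun⟩ := runTok_pairProg x (N / 2 - 1) hm
  have hab : lastA N ≠ lastB N := idx_ne (by omega) hm (by omega)
  have hs := relSign_eq_or x (2 * (N / 2 - 1) + 2)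
  -- after decoding: `c • |j, 0⟩` with `j = a` (even so far) or `j = b` (odd so far)
  have hdec : runTok x (pairProg N (N / 2 - 1) ++
      [QTok.gate (hadGate (lastA N) (lastB N)), QTok.gate (trotGU N)]) (Pi.single (startP N) 1) =
      c • Pi.single ((if relSign x (2 * (N / 2 - 1) + 2) = 1 then lastA N else lastB N), false, ())
        (1 : ℂ) := by
    rw [runTok_append, hrun]
    simp only [runTok_cons, runTok_nil, QTok.mat]
    rw [Matrix.mulVec_smul, Matrix.mulVec_smul]
    erw [hadGate_mulVec_tens hab hs, trotGU_mulVec_tens_ketMinus, tens_single_ketZero]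
  rw [parityAlg, toAlg_acceptProb, parityProg, endProg, acceptP]
  by_cases hodd : N % 2 = 1
  · -- odd `N`: route the decoded bit into the target at index `N − 1`, then one classical query
    rw [if_pos hodd, if_pos hodd, ← List.append_assoc, runTok_append, hdec]
    simp only [runTok_cons, runTok_nil, QTok.mat]
    rw [Matrix.mulVec_smul, Matrix.mulVec_smul]
    have hlast : 2 * (N / 2 - 1) + 2 = N - 1 := by omega
    have hlb : (lastB N, false, ()) ≠ (idx N (N - 1), false, ()) := by
      intro h; exact idx_ne (by omega) (by omega) (by omega) (congrArg Prod.fst h)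
    have hab' : (lastB N, false, ()) ≠ (lastA N, false, ()) := by
      intro h; exact hab.symm (congrArg Prod.fst h)
    have htA : (tailPerm N).symm (lastA N, false, ()) = (idx N (N - 1), false, ()) := by
      rw [Equiv.symm_apply_eq, tailPerm, Equiv.Perm.mul_apply,
        Equiv.swap_apply_of_ne_of_ne (by
          intro h; have := congrArg (fun p => p.2.1) h; simp at this) hlb.symm,
        Equiv.swap_apply_left]
    have htB : (tailPerm N).symm (lastB N, false, ()) = (idx N (N - 1), true, ()) := by
      rw [Equiv.symm_apply_eq, tailPerm, Equiv.Perm.mul_apply, Equiv.swap_apply_left,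
        Equiv.swap_apply_of_ne_of_ne hlb hab']
    rw [permGate_mulVec_single]
    have hfull : relSign x N = sgnC (x (idx N (N - 1))) * relSign x (N - 1) := by
      have h := relSign_succ x (N - 1)
      rwa [show N - 1 + 1 = N by omega] at h
    rcases hs with h1 | h1
    · rw [if_pos h1, htA, queryOracle_mulVec_single, wt_singleton_smul_single hc]
      rw [hlast] at h1
      have hpar : relSign x N = sgnC (x (idx N (N - 1))) := by rw [hfull, h1, mul_one]
      rw [relSign_self] at hpar
      cases hx : x (idx N (N - 1))
      · rw [hx] at hpar
        have hne : ¬ Odd (hw x) := by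
          intro ho; rw [if_pos ho] at hpar; norm_num [sgnC] at hpar
        rw [if_neg hne, if_neg]
        intro h; have := congrArg (fun p => p.2.1) h; simp at this
      · rw [hx] at hpar
        have ho : Odd (hw x) := by
          by_contra hno; rw [if_neg hno] at hpar; norm_num [sgnC] at hpar
        rw [if_pos ho, if_pos]
        rfl
    · have hne1 : ¬ relSign x (2 * (N / 2 - 1) + 2) = 1 := by rw [h1]; norm_num
      rw [if_neg hne1, htB, queryOracle_mulVec_single, wt_singleton_smul_single hc]
      rw [hlast] at h1
      have hpar : relSign x N = -sgnC (x (idx N (N - 1))) := by rw [hfull, h1]; ring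
      rw [relSign_self] at hpar
      cases hx : x (idx N (N - 1))
      · rw [hx] at hpar
        have ho : Odd (hw x) := by
          by_contra hno; rw [if_neg hno] at hpar; norm_num [sgnC] at hpar
        rw [if_pos ho, if_pos]
        rfl
      · rw [hx] at hpar
        have hne : ¬ Odd (hw x) := by
          intro ho; rw [if_pos ho] at hpar; norm_num [sgnC] at hpar
        rw [if_neg hne, if_neg]
        intro h; have := congrArg (fun p => p.2.1) h; simp at this
  · -- even `N`: the decoded index already carries the parity
    rw [if_neg hodd, if_neg hodd, List.append_nil, hdec, wt_singleton_smul_single hc]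
    have hlast : 2 * (N / 2 - 1) + 2 = N := by omega
    rw [hlast] at hs ⊢
    have hself := relSign_self x
    rcases hs with h1 | h1
    · rw [if_pos h1]
      have hne : ¬ Odd (hw x) := by
        intro ho; rw [h1, if_pos ho] at hself; norm_num at hself
      rw [if_neg hne, if_neg]
      intro h; exact hab (congrArg Prod.fst h)
    · have hne1 : ¬ relSign x N = 1 := by rw [h1]; norm_num
      rw [if_neg hne1]
      have ho : Odd (hw x) := by
        by_contra hno; rw [h1, if_neg hno] at hself; norm_num at hself
      rw [if_pos ho, if_pos rfl]

/-- The program computes PARITY with error `0` on every input (`N ≥ 2`). [cite: BealsEtAl2001, Prop. 6.4] -/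
theorem parityAlg_computesWithError [NeZero N] (hN : 2 ≤ N) :
    (parityAlg N).ComputesWithError 0 Set.univ fun x => decide (Odd (hw x)) := by
  intro x _
  rw [parityAlg_acceptProb hN]
  constructor
  · intro h
    rw [decide_eq_true_eq] at h
    rw [if_pos h]; norm_num
  · intro h
    have h' : ¬ Odd (hw x) := by simpa using h
    rw [if_neg h']

/-! ### Proposition 6.4, exact clause -/

/-- **Ceiling: `Q_ε(PARITY_N) ≤ ⌈N/2⌉`** for every `0 ≤ ε` ("this is also sufficient … compute the XOR
of all `N/2` pairs using `N/2` queries"). [cite: BealsEtAl2001, Prop. 6.4] -/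
theorem quantumQueryComplexity_parity_le {ε : ℝ} (hε : 0 ≤ ε) :
    quantumQueryComplexity ε (fun x : Fin N → Bool => decide (Odd (hw x))) ≤ (N + 1) / 2 := by
  rcases Nat.lt_or_ge N 2 with hN | hN
  · -- `N ≤ 1`: `N` queries always suffice, and `N = ⌈N/2⌉`
    refine (quantumQueryComplexity_le_holds ε hε _).trans ?_
    interval_cases N <;> norm_num
  · haveI : NeZero N := NeZero.of_pos (by omega)
    change quantumQueryComplexityOn ε Set.univ _ ≤ _
    rw [← parityAlg_queries hN]
    exact Nat.sInf_le ⟨parityAlg N, rfl,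
      (parityAlg_computesWithError hN).mono hε (Set.subset_univ _)⟩

/-- The top Walsh coefficient of PARITY: `Σ_x [Odd |x|]·χ_[N](x) = −#{x : Odd |x|}`
("PARITY has `deg(f) = N`"). [cite: BealsEtAl2001, §6] -/
theorem sum_ind_parity_mul_walsh_univ :
    ∑ x : Fin N → Bool, (if decide (Odd (hw x)) = true then (1 : ℝ) else 0) * walsh univ x =
      -((Finset.univ.filter fun x : Fin N → Bool => Odd (hw x)).card : ℝ) := by
  rw [Finset.card_filter, Nat.cast_sum, ← Finset.sum_neg_distrib]
  refine Finset.sum_congr rfl fun x _ => ?_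
  rw [walsh_univ_eq_neg_one_pow_hw]
  by_cases h : Odd (hw x)
  · simp [h, h.neg_one_pow]
  · simp [h]

/-- That coefficient is nonzero for `N ≥ 1` (the string `e₀` has odd weight). [cite: BealsEtAl2001, §6] -/
theorem sum_ind_parity_mul_walsh_univ_ne_zero (hN : 1 ≤ N) :
    ∑ x : Fin N → Bool, (if decide (Odd (hw x)) = true then (1 : ℝ) else 0) * walsh univ x ≠ 0 := by
  rw [sum_ind_parity_mul_walsh_univ, neg_ne_zero, Nat.cast_ne_zero, ← Nat.pos_iff_ne_zero,
    Finset.card_pos]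
  refine ⟨fun i => decide (i = ⟨0, hN⟩), Finset.mem_filter.2 ⟨Finset.mem_univ _, ?_⟩⟩
  have h1 : hw (fun i : Fin N => decide (i = ⟨0, hN⟩)) = 1 := by
    unfold hw
    rw [Finset.card_eq_one]
    exact ⟨⟨0, hN⟩, by ext i; simp⟩
  rw [h1]; exact odd_one

/-- **Floor (Thm. 4.3 for PARITY): every error-free algorithm for PARITY makes `2T ≥ N` queries.**
[cite: BealsEtAl2001, Prop. 6.4] -/
theorem le_two_mul_queries_of_computesWithError_zero_parity (A : QQueryAlg N)
    (hA : A.ComputesWithError 0 Set.univ fun x => decide (Odd (hw x))) : N ≤ 2 * A.queries := by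
  rcases Nat.eq_zero_or_pos N with rfl | hN
  · exact Nat.zero_le _
  by_contra hlt
  have hdeg : Literature.Combinatorics.Optimization.HasDegreeLE (2 * A.queries)
      fun x : Fin N → Bool => if decide (Odd (hw x)) = true then (1 : ℝ) else 0 := by
    obtain ⟨P, hP, h⟩ := hasDegreeLE_acceptProb A
    exact ⟨P, hP, fun x => by rw [h x]; exact acceptProb_eq_ind A hA x⟩
  exact sum_ind_parity_mul_walsh_univ_ne_zero hN (sum_mul_walsh_univ_eq_zero (not_le.1 hlt) hdeg)

/-- **Floor: `⌈N/2⌉ ≤ Q_E(PARITY_N)`.** [cite: BealsEtAl2001, Prop. 6.4] -/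
theorem le_quantumQueryComplexity_zero_parity :
    (N + 1) / 2 ≤ quantumQueryComplexity 0 (fun x : Fin N → Bool => decide (Odd (hw x))) := by
  rcases Nat.eq_zero_or_pos N with rfl | hN
  · exact Nat.zero_le _
  · haveI : NeZero N := NeZero.of_pos hN
    obtain ⟨A, hq, hA⟩ := exists_queries_eq_quantumQueryComplexityOn (N := N) (le_refl (0 : ℝ))
      Set.univ (fun x : Fin N → Bool => decide (Odd (hw x)))
    change (N + 1) / 2 ≤ quantumQueryComplexityOn 0 Set.univ _
    rw [← hq]
    have := le_two_mul_queries_of_computesWithError_zero_parity A hA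
    omega

/-- **Beals–Buhrman–Cleve–Mosca–de Wolf, Prop. 6.4 (exact clause): `Q_E(PARITY_N) = ⌈N/2⌉`.**
[cite: BealsEtAl2001, Prop. 6.4] -/
theorem quantumQueryComplexity_zero_parity :
    quantumQueryComplexity 0 (fun x : Fin N → Bool => decide (Odd (hw x))) = (N + 1) / 2 :=
  le_antisymm (quantumQueryComplexity_parity_le le_rfl) le_quantumQueryComplexity_zero_parity


/-! ### Checks (the in-file falsifiers asked for on the cell bus) -/

/-- The acceptance probability of the program is `{0,1}`-valued at every input (exactness, by the
closed form). [cite: BealsEtAl2001, Prop. 6.4] -/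
example [NeZero N] (hN : 2 ≤ N) (x : Fin N → Bool) :
    (parityAlg N).acceptProb x = 0 ∨ (parityAlg N).acceptProb x = 1 := by
  rw [parityAlg_acceptProb hN]
  split_ifs <;> simp

/-- `N = 2`: one query decides `x₀ ⊕ x₁` (Deutsch). [cite: CleveEtAl1998, §3] -/
example : numQueries (parityProg 2) = 1 := numQueries_parityProg (N := 2) (by norm_num)

/-- `N = 3`: two queries. [cite: BealsEtAl2001, Prop. 6.4] -/
example : numQueries (parityProg 3) = 2 := numQueries_parityProg (N := 3) (by norm_num)

/-- `N = 1`: `Q_E(x₀) = 1 = ⌈1/2⌉` (one classical query; the floor side is the degree bound).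
[cite: BealsEtAl2001, Prop. 6.4] -/
example : quantumQueryComplexity 0 (fun x : Fin 1 → Bool => decide (Odd (hw x))) = 1 :=
  quantumQueryComplexity_zero_parity

/-- `N = 2`: `Q_E(x₀ ⊕ x₁) = 1`. [cite: BealsEtAl2001, Prop. 6.4] -/
example : quantumQueryComplexity 0 (fun x : Fin 2 → Bool => decide (Odd (hw x))) = 1 :=
  quantumQueryComplexity_zero_parity

/-- `N = 3`: `Q_E(PARITY₃) = 2`. [cite: BealsEtAl2001, Prop. 6.4] -/
example : quantumQueryComplexity 0 (fun x : Fin 3 → Bool => decide (Odd (hw x))) = 2 :=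
  quantumQueryComplexity_zero_parity

end Literature.Computability.QuantumComplexity.ExactParity

end
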